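import Summits.QuantumFields.YangMills.Theorems.WeakCouplingMasslessPhaseDeconfinedIsMasslessStrongCouplingCentre
import Literature.MathematicalPhysics.QuantumLattice.StrongExpDecayCentreSymmetry
import HarnessLib

/-!
# Crux `DeconfinedIsMassless` (stmt-QuantumFields-19521), stub A from Chatterjee's Definition 2.3:
# exponential decay under arbitrary boundary conditions ⇒ unbroken slab centre symmetry (route-independent part)

Helper file (`--supports stmt-QuantumFields-19521 --as helper`, closes nothing) of the PORT lane `ym-lit-19521-confcrit` (g2)
for the crux `DeconfinedIsMassless` of the REFUTATION route `route-QuantumFields-WeakCouplingMasslessPhase`, registered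
skeleton `Cruxes/DeconfinedIsMassless/Lines/birth.lean` (sha `ebd9e11d7074`): stub A `stub_centreUnbroken_of_torusClustering`
(open: torus clustering of ONE pair of species ⇒ slab centre symmetry unbroken at some width under every boundary condition)
and stub B `stub_not_perimeter_of_centreUnbroken` (LANDED, p530803). The route tribunal's reshape advice (J addendum g1 (b))
cuts stub A as `A2 ∘ A1` with **A2 = the CENTRE HALF of Chatterjee's Theorem 2.4** (`HasStrongExpDecayZd 4 ρ β → CentreUnbroken 4 ρ β`)
and A1 = «torus clustering of one pair ⇒ `HasStrongExpDecayZd 4 r.ρ β`» (the genuinely open bridge).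

A2 is now a Literature THEOREM for every compact gauge group (`centreUnbroken_of_hasStrongExpDecayZd`,
`StrongExpDecayCentreSymmetry.lean`, this lane: Cor. 7.4 on cubes ⇒ decaying one-link influence of the cube kernels ⇒
Dobrushin–Shlosman's window comparison under the averaged condition `C_V` for the full-height cubes of the slab ⇒ slab
uniqueness ⇒ centre symmetry). This file records its ROUTE-INDEPENDENT consequences (imports no `Theses` module, so that
positive routes can use them without entering the route's cone), sorry-free, no new definition:

* `centreUnbroken_of_hasStrongExpDecay_rep` — Def. 2.3 ⇒ Def. 2.1 for the `r`-Wilson theory of `SU(N)₄`.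
* `slabCentre_inlined_of_hasStrongExpDecay` — **stub A's CONCLUSION from Definition 2.3** (A2 in the planner's inlined
  currency, via `inlined_of_slabCentreUnbroken`).
* ★ `stub_centreUnbroken_of_torusClustering_of_hasStrongExpDecay` — the RUNG in the registered shape: stub A with the single
  extra hypothesis `HasStrongExpDecayZd 4 r.ρ β` (the clustering hypothesis is then not needed).

The compositions with the landed stub B (no perimeter law; the crux reduces by name to A1) are in the companion file
`…DeconfinedIsMasslessStrongExpDecayNoPerimeter.lean` (route cone).

HONEST FRAMING. A1 (one-pair torus clustering ⇒ decay under ARBITRARY boundary conditions for ALL local observables) is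
open and carries all of stub A's remaining difficulty; nothing here bears on it, nor on the mass gap.

Sources: S. Chatterjee, CMP 385 (2021) 1007–1039, arXiv:2006.16229, Def. 2.1, Def. 2.3, Thm. 2.4;
R. L. Dobrushin, S. B. Shlosman (1985), Thm. 1; H.-O. Georgii (2011), Thm. 8.20.
-/

set_option autoImplicit false

noncomputable section

namespace Summit.QuantumFields.YangMills.Theorems.DeconfinedIsMassless

open MeasureTheory Filter Topology
open Literature.Probability.LatticeModels
open Literature.MathematicalPhysics
open Literature.MathematicalPhysics.QuantumLattice

variable {N : ℕ}

/-! ### A2: Definition 2.3 ⇒ Definition 2.1 for the `r`-Wilson theory of `SU(N)₄` -/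

/-- **Chatterjee's Theorem 2.4 (centre half) for the `r`-Wilson theory of `SU(N)₄`**: exponential decay of correlations
under arbitrary boundary conditions (`HasStrongExpDecayZd 4 r.ρ β`, Def. 2.3) implies unbroken centre symmetry
(`CentreUnbroken 4 r.ρ β`, Def. 2.1) — the Literature theorem `centreUnbroken_of_hasStrongExpDecayZd` at `G = SU(N)`.
[cite: Chatterjee2021, Thm. 2.4] -/
theorem centreUnbroken_of_hasStrongExpDecay_rep (r : QuantumFieldTheory.LatticeRep (Matrix.specialUnitaryGroup (Fin N) ℂ))
    (β : ℝ) (h : HasStrongExpDecayZd 4 r.ρ β) : CentreUnbroken 4 r.ρ β :=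
  centreUnbroken_of_hasStrongExpDecayZd (d := 4) r.ρ r.continuous h

/-- ★ **Stub A's conclusion from Definition 2.3** (A2 in the planner's inlined currency): for every `N`, every lattice
representation `r` of `SU(N)` and every `β` with `HasStrongExpDecayZd 4 r.ρ β` there is a width `W ≥ 1` at which the inlined
slab centre symmetry is unbroken under every boundary condition. [cite: Chatterjee2021, Thm. 2.4] -/
theorem slabCentre_inlined_of_hasStrongExpDecay (r : QuantumFieldTheory.LatticeRep (Matrix.specialUnitaryGroup (Fin N) ℂ))
    (β : ℝ) (h : HasStrongExpDecayZd 4 r.ρ β) :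
    ∃ W : ℕ, 1 ≤ W ∧ ∀ (δ : QuantumLattice.LGConfig 4 (Matrix.specialUnitaryGroup (Fin N) ℂ)) (μ : Measure (QuantumLattice.LGConfig 4 (Matrix.specialUnitaryGroup (Fin N) ℂ))), IsProbabilityMeasure μ → (∀ᵐ U ∂μ, ∀ e : QuantumLattice.ZdEdge 4, ¬ ((e.2 = 0 ∧ 0 ≤ e.1 0 ∧ e.1 0 < (W : ℤ)) ∨ (e.2 ≠ 0 ∧ 0 < e.1 0 ∧ e.1 0 < (W : ℤ))) → U e = δ e) → (∀ Λ : Finset (QuantumLattice.ZdEdge 4), (∀ e ∈ Λ, (e.2 = 0 ∧ 0 ≤ e.1 0 ∧ e.1 0 < (W : ℤ)) ∨ (e.2 ≠ 0 ∧ 0 < e.1 0 ∧ e.1 0 < (W : ℤ))) → ∀ E : Set (QuantumLattice.LGConfig 4 (Matrix.specialUnitaryGroup (Fin N) ℂ)), MeasurableSet E → ∫⁻ η, QuantumLattice.ymSpecification (d := 4) r.ρ β Λ η E ∂μ = μ E) → ∀ z : Matrix.specialUnitaryGroup (Fin N) ℂ, z ∈ Subgroup.center (Matrix.specialUnitaryGroup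 (Fin N) ℂ) → μ.map (fun (U : QuantumLattice.LGConfig 4 (Matrix.specialUnitaryGroup (Fin N) ℂ)) (e : QuantumLattice.ZdEdge 4) => if e.2 = 0 ∧ e.1 0 = 0 then z * U e else U e) = μ := by
  obtain ⟨W, hW, hcentre⟩ := centreUnbroken_of_hasStrongExpDecay_rep r β h
  exact ⟨W, hW, inlined_of_slabCentreUnbroken r.ρ β hcentre⟩

/-- ★ **RUNG of stub A (registered shape + the hypothesis of Chatterjee's Definition 2.3).** For every `N ≥ 2` and every
lattice representation `r` of `SU(N)` there are species `A, B` (here both `r.curvature`; any pair works) such that for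
every `β > 0` with `HasStrongExpDecayZd 4 r.ρ β`: [the crux's uniform torus-clustering clause — not used] ⇒ there is a width
`W ≥ 1` at which the inlined slab centre symmetry is unbroken under every boundary condition. Stub A asserts this WITHOUT the
decay hypothesis; the remaining content of stub A is therefore the bridge «torus clustering of one pair ⇒ Def. 2.3» (A1).
[cite: Chatterjee2021, Thm. 2.4] -/
theorem stub_centreUnbroken_of_torusClustering_of_hasStrongExpDecay :
    ∀ (N : ℕ), 2 ≤ N → ∀ r : QuantumFieldTheory.LatticeRep (Matrix.specialUnitaryGroup (Fin N) ℂ), ∃ A B : QuantumFieldTheory.YMSpecies (Matrix.specialUnitaryGroup (Fin N) ℂ), ∀ β : ℝ, 0 < β → HasStrongExpDecayZd 4 r.ρ β → (∃ (C m : ℝ) (S₀ : ℕ), 0 < m ∧ ∀ S : ℕ, S₀ ≤ S → ∀ n : ℕ, n ≤ S → |QuantumFieldTheory.latticeConnectedCorr r.ρ β (2 * S + 1) A.F B.F n| ≤ C * Real.exp (-(m * n))) → ∃ W : ℕ, 1 ≤ W ∧ ∀ (δ : QuantumLattice.LGConfig 4 (Matrix.specialUnitaryGroup (Fin N) ℂ))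 (μ : Measure (QuantumLattice.LGConfig 4 (Matrix.specialUnitaryGroup (Fin N) ℂ))), IsProbabilityMeasure μ → (∀ᵐ U ∂μ, ∀ e : QuantumLattice.ZdEdge 4, ¬ ((e.2 = 0 ∧ 0 ≤ e.1 0 ∧ e.1 0 < (W : ℤ)) ∨ (e.2 ≠ 0 ∧ 0 < e.1 0 ∧ e.1 0 < (W : ℤ))) → U e = δ e) → (∀ Λ : Finset (QuantumLattice.ZdEdge 4), (∀ e ∈ Λ, (e.2 = 0 ∧ 0 ≤ e.1 0 ∧ e.1 0 < (W : ℤ)) ∨ (e.2 ≠ 0 ∧ 0 < e.1 0 ∧ e.1 0 < (W : ℤ))) → ∀ E : Set (QuantumLattice.LGConfig 4 (Matrix.specialUnitaryGroup (Fin N) ℂ)), MeasurableSet E → ∫⁻ η, QuantumLattice.ymSpecification (d := 4) r.ρ β Λ η E ∂μ = μ E) → ∀ z : Matrix.specialUnitaryGroup (Fin N) ℂ, z ∈ Subgroup.center (Matrix.specialUnitaryGroup (Fin N) ℂ) → μ.map (fun (U : QuantumLattice.LGConfig 4 (Matrix.specialUnitaryGroup (Fin N) ℂ)) (e : QuantumLattice.ZdEdge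 4) => if e.2 = 0 ∧ e.1 0 = 0 then z * U e else U e) = μ := by
  intro N _hN r
  exact ⟨r.curvature, r.curvature, fun β _hβ hdecay _hclust => slabCentre_inlined_of_hasStrongExpDecay r β hdecay⟩

end Summit.QuantumFields.YangMills.Theorems.DeconfinedIsMassless

end
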